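import Summits.BirchSwinnertonDyer.Rank1Residual.Additive.RamifiedSevenGenusKatoPinnedFrame
import Literature.NumberTheory.EllipticCurves.ZpExtensionLayerComplexCharacter
import HarnessLib

set_option autoImplicit false

/-!
# `𝒞₇` genus road (crux `EllipticUnitValueSevenOfGZK`, K7r), row (K2C-2): the binder `hχ` of the K2ᶜ input form DISCHARGED —
# characters of every primitive level of `Kℚ_∞/K` at a pinned frame (THEOREMS ONLY)

Cell bsd-cm, seat bsd-cm-prr-ty1 g30 (literature-prover).  The K2ᶜ input form `h` of ★ `integralComparisonSeven_of_inputs`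
(`RamifiedSevenIntegralComparisonOfInputs.lean`, p782137; the prospective `stub_integralComparisonInputsSeven` of zp v13, pen
D914/D918) carries the conjunct
`hχ : ∀ n, ∃ χ : Γ_{Kcm} →ₜ* ℂˣ, (∀ σ ∈ U_{n+1}, χ σ = 1) ∧ IsPrimitiveRoot (χ γK) (7^{n+1})`
(characters of exact level `n+1` of the cyclotomic `ℤ₇`-extension of the CM field).  It is a THEOREM for every pinned frame:
`PinnedKatoGenusFrame.exists_character_isPrimitiveRoot`, from the Literature lemma
`ZpExtension.exists_continuousMonoidHom_layer_isPrimitiveRoot` (layer character `κ mod 7^{n+1}` composed with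
`a ↦ exp(2πi a/7^{n+1})`) at `γK`, `isTopGenerator_γK`.  So whoever inhabits `h` takes this conjunct from here; nothing else
of `h` is touched.  HONEST LABEL: a conditional-free lemma about the frame's own data; nothing about 19945 is asserted; no stub
closes; no summit statement is proved by this seat; 19945 OPEN; `X12.CMRamifiedSeven` NOT proved; BSD is claimed for no curve.

References: L. C. Washington (1997) §13.1–13.2 [Washington1997]; K. Kato, Astérisque 295 (2004) §13.9 (p. 230: characters of
`Gal(ℚ(ζ_{p^n})/ℚ)` in Thm. 12.5) [Kato2004Asterisque]; (P1) p776025; p782137.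
-/

noncomputable section

open scoped NumberField
open Field NumberField
open Literature.NumberTheory.GaloisRepresentations
open Literature.NumberTheory.EllipticCurves
open Literature.NumberTheory.EllipticCurves.Rank1Residual
open Literature.NumberTheory.EllipticCurves.Kato2004
open Literature.NumberTheory.ComplexMultiplication.EllipticUnits
open Summit.BirchSwinnertonDyer.Rank1Residual

namespace Summit.BirchSwinnertonDyer.Rank1Residual.Additive.GenusSeven

section Frame

variable {W : WeierstrassCurve ℚ} [W.IsElliptic] [W.IsGloballyMinimal] [Fact (Nat.Prime 7)]
  [ContinuousSMul ℤ_[7] (W.tateModule 7)] {K : ZpExtension ℚ 7} {hK : K.IsCyclotomic}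
  {γ : Field.absoluteGaloisGroup ℚ} {I : IwasawaH1Data W 7 K γ}
  {F : GenusFrame} {θu : ∀ n : ℕ, globalUnitsOf (F.layer n)} {d : GenusDatum F θu}

/-- **Binder `hχ` discharged**: at a pinned frame, for every `n` there is a continuous character `χ` of `Γ_{Kcm}` trivial on
the layer subgroup `U_{n+1}` of `Kℚ_∞/K` with `χ(γK)` a primitive `7^{n+1}`-th root of unity.
[cite: Washington1997, §13.1–13.2] [cite: Kato2004Asterisque, §13.9 (p. 230)] -/
theorem PinnedKatoGenusFrame.exists_character_isPrimitiveRoot (Φ : PinnedKatoGenusFrame W K hK I d) (n : ℕ) :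
    ∃ χ : absoluteGaloisGroup Φ.Kcm →ₜ* ℂˣ,
      (∀ σ ∈ (K.restrictOfFinrankEqTwo (by decide) Φ.Kcm Φ.finrank_Kcm).layerSubgroup (n + 1), χ σ = 1) ∧
        IsPrimitiveRoot (((χ Φ.γK : ℂˣ)) : ℂ) (7 ^ (n + 1)) :=
  ZpExtension.exists_continuousMonoidHom_layer_isPrimitiveRoot _ Φ.isTopGenerator_γK n

/-- The `hχ` conjunct of the K2ᶜ input form, in its exact letter, holds at every pinned frame.
[cite: Washington1997, §13.1–13.2] -/
theorem PinnedKatoGenusFrame.hχ_of_inputs (Φ : PinnedKatoGenusFrame W K hK I d) :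
    ∀ n : ℕ, ∃ χ : absoluteGaloisGroup Φ.Kcm →ₜ* ℂˣ,
      (∀ σ ∈ (K.restrictOfFinrankEqTwo (by decide) Φ.Kcm Φ.finrank_Kcm).layerSubgroup (n + 1), χ σ = 1) ∧
        IsPrimitiveRoot (((χ Φ.γK : ℂˣ)) : ℂ) (7 ^ (n + 1)) :=
  fun n => Φ.exists_character_isPrimitiveRoot n

end Frame

end Summit.BirchSwinnertonDyer.Rank1Residual.Additive.GenusSeven

end
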